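import Summits.ResolutionOfSingularities.ResolutionOfSingularities.Theorems.WildQuotientsSummitReductionStubPairOrbitBlowupCentreLocalLemmas2
import Summits.ResolutionOfSingularities.ResolutionOfSingularities.Theorems.WildQuotientsSummitReductionStubPairOrbitBlowupCentreLocalLemmas4
import HarnessLib

/-!
# `WildQuotients.SummitReduction` (stmt-ResolutionOfSingularities-16324), line `FramePerfect`:
# "completion commutes with blowing up" — the transfer from the formal model to the blown-up curve,
# and the quasi-split datum at the points over the chart origins (stub `stub_pair_orbitBlowupCentreLocal`, file 3)

Route `ResolutionOfSingularities/WildQuotients`, crux `SummitReduction`; helper file of stub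
`stub_pair_orbitBlowupCentreLocal` (C2: de Jong 1996, 3.4 Claim (ii) over the orbit centre, with
quasi-splitness upstairs, de Jong 1997, proof of Prop. 5.11 ¶1) of the line skeleton
`Cruxes/SummitReduction/Lines/FramePerfect.lean` (v8). De Jong 1996, p. 64, l. 1–2: "We remark that
completion and blowing up commute in a suitable manner, so that it suffices to compute the blow up of
`Spec B'` (3.3) in the ideal `(u, v, t₁)`." This file PROVES that transfer for the completed local
rings of the blown-up curve, in the form the stub consumes:

* `exists_chart_localCpl_equiv_of_isBlowup_of_nodeDeformationRing_compat` — for a blow-up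
  `π : X' → X` along `I`, `f : X → Y`, and a point `x'` whose image `z = π x'` carries a formal model
  `𝒪̂_{X,z} ≅ Λ⟦u, v⟧/(uv - c t²)` sending `I_z` to `(u, v, t)` and defined over `β : 𝒪_{Y,f z} → Λ`
  (the data of `centreFlat_exists_nodeDeformationRing_orbitCentre_compat`, stub C1, and of the
  tree's `flat_stalkMap_comp_of_isBlowup_of_nodeDeformationRing`): **`𝒪̂_{X',x'}` is the completion
  of one of the three chart rings `Λ[U, T']/(UT' - t)`, `Λ[V, T']/(VT' - t)`, `Λ[U', V']/(U'V' - c)`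
  at a prime `𝔔 ⊇ 𝔪_Λ`, compatibly with `𝒪_{Y,f z} → 𝒪_{X',x'}` resp. `𝒪_{Y,f z} → Λ → (chart)_𝔔`**
  (base change along the flat `Spec 𝒪_{X,z} → X` — local rings unchanged — and along
  `Spec Λ⟦u,v⟧/(uv - ct²) → Spec 𝒪_{X,z}` — completed local rings unchanged, file 1 — lands in a
  blow-up of the formal model, whose completed local rings over the closed point are those of the
  charts, file 2);
* `exists_chart_and_quasiSplitDatum_of_nodeDeformationRing_compat` — **the same, packaged with the
  quasi-split datum of the line at `x'` whenever the chart prime is the ORIGIN `(x̄, ȳ)` of the special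
  fibre `κ[x, y]/(xy)`** (file 4: the completed fibre local ring is then `κ(f z)⟦u, v⟧/(uv)` compatibly
  with `κ(f z)` — "the singular points of the fibres of `X' → Y` in `E` are rational with rational
  tangents", de Jong 1997, p. 618), for `β` residually onto with `𝔪_{f z} Λ = 𝔪_Λ` (true for the
  Cohen-coordinate `β = (𝒪_{Y,f z} → 𝒪̂_{Y,f z} ≅ κ⟦T⟧)` of stub C1). What is left of (H4) of the stub
  after this file is the complementary case: at a chart prime NOT containing both `x̄` and `ȳ`, the
  morphism `π ≫ f` is smooth at `x'` (the chart ring is there a localization of `Λ[Z, Z⁻¹]`).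
-/

set_option linter.dupNamespace false

noncomputable section

open CategoryTheory CategoryTheory.Limits AlgebraicGeometry TopologicalSpace TensorProduct
open Literature.AlgebraicGeometry.Resolution
open IsLocalRing Scheme.IdealSheafData

namespace Summit.ResolutionOfSingularities.ResolutionOfSingularities.Theorems

universe u

/-! ## The transfer to the blown-up curve: completed local rings of `X'` at the points over a formal model -/

section Transfer

open DeJong1996 DeJong1996.AlgebraicNodeRing

set_option maxHeartbeats 800000 in
/-- **De Jong 1996, 3.4 Claim (ii), "completion commutes with blowing up" — the transfer from the
formal model to the blown-up curve.** Let `π : X' → X` be a blow-up along an ideal sheaf `I` (`X`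
locally Noetherian), `f : X → Y`, and `x' ∈ X'` a point whose image `z = π x'` carries a formal model
`e : 𝒪̂_{X,z} ≅ B̂' = Λ⟦u, v⟧/(uv - c t²)` (`Λ` local Noetherian, `t ∈ Λ⁰`) sending `I_z 𝒪̂_{X,z}` to
`(u, v, t) B̂'` and defined over a ring map `β : 𝒪_{Y,f z} → Λ`. Then the completed local ring
`𝒪̂_{X',x'}` is the completion of one of the three chart rings `Λ[U, T']/(UT' - t)`,
`Λ[V, T']/(VT' - t)`, `Λ[U', V']/(U'V' - c)` at a prime `𝔔` over `𝔪_Λ`, compatibly with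
`𝒪_{Y,f z} → 𝒪_{X',x'}` on the one side and `𝒪_{Y,f z} → Λ → (chart ring)_𝔔` on the other. Proof:
base change `π` along the flat `Spec 𝒪_{X,z} → X` and then along `Spec B̂' → Spec 𝒪_{X,z}`; the
first does not change the local ring at the point over `x'`, the second does not change its
completion (file 1: `𝒪_{X,z} → 𝒪̂_{X,z}` is bijective on all levels of `𝔪_z`), and the result is a
blow-up of `Spec B̂'` in `(u, v, t)`, whose completed local rings over the closed point are those of
the charts (`exists_chart_localCpl_equiv_of_isBlowup_nodeDeformationRing`).
[cite: DeJong1996, 3.4 Claim (ii), pp. 63–64] -/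
theorem exists_chart_localCpl_equiv_of_isBlowup_of_nodeDeformationRing_compat {X' X Y : Scheme.{u}}
    [IsLocallyNoetherian X] (π : X' ⟶ X) (f : X ⟶ Y) {I : X.IdealSheafData} (hπ : IsBlowup π I)
    {x' : X'} {Λ : Type u} [CommRing Λ] [IsLocalRing Λ] [IsNoetherianRing Λ] {c t : Λ}
    (ht : t ∈ nonZeroDivisors Λ)
    (e : AdicCompletion (maximalIdeal (X.presheaf.stalk (π x'))) (X.presheaf.stalk (π x')) ≃+*
      NodeDeformationRing Λ (c * t ^ 2))
    (hcentre : ((stalkIdeal I (π x')).map (algebraMap (X.presheaf.stalk (π x'))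
        (AdicCompletion (maximalIdeal (X.presheaf.stalk (π x'))) (X.presheaf.stalk (π x'))))).map
        e.toRingHom =
      (nodalCentre Λ c t).map (AlgebraicNodeRing.toNodeDeformationRing Λ (c * t ^ 2)).toRingHom)
    (β : Y.presheaf.stalk (f (π x')) →+* Λ)
    (hcompat : ∀ a, e (algebraMap _ _ ((f.stalkMap (π x')).hom a)) =
      algebraMap Λ (NodeDeformationRing Λ (c * t ^ 2)) (β a)) :
    ∃ (j : Fin 3) (𝔔 : Ideal (AlgebraicNodeRing Λ (chartParam Λ c t j))) (_ : 𝔔.IsPrime)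
      (E : LocalCpl (X'.presheaf.stalk x') ≃+* LocalCpl (Localization.AtPrime 𝔔)),
      (maximalIdeal Λ).map (algebraMap Λ (AlgebraicNodeRing Λ (chartParam Λ c t j))) ≤ 𝔔 ∧
      ∀ a : Y.presheaf.stalk (f (π x')), E (AdicCompletion.of _ _ (((π ≫ f).stalkMap x').hom a)) =
        AdicCompletion.of _ _ (algebraMap Λ (Localization.AtPrime 𝔔) (β a)) := by
  classical
  let O : CommRingCat.{u} := X.presheaf.stalk (π x')
  let Ocpl := AdicCompletion (maximalIdeal O) O
  let N := NodeDeformationRing Λ (c * t ^ 2)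
  haveI : IsNoetherianRing (MvPowerSeries (Fin 2) Λ) := isNoetherianRing_mvPowerSeries Λ (Fin 2)
  haveI : IsNoetherianRing N := inferInstanceAs (IsNoetherianRing (_ ⧸ _))
  haveI : Nontrivial N := e.injective.nontrivial
  haveI : IsLocalRing N := IsLocalRing.of_surjective' (e : Ocpl →+* N) e.surjective
  -- the flat local map `cmap : 𝒪_{X,z} → 𝒪̂ ≅ N` as an algebra structure on `N`
  letI algON : Algebra O N := ((e : Ocpl →+* N).comp (algebraMap O Ocpl)).toAlgebra
  have hc : (algebraMap O N : O →+* N) = (e : Ocpl →+* N).comp (algebraMap O Ocpl) := rfl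
  haveI : IsLocalHom (algebraMap O N) := by
    rw [hc]; infer_instance
  have hcflat : (algebraMap O N).Flat := by
    rw [hc]
    exact RingHom.Flat.comp (RingHom.flat_algebraMap_iff.mpr (AdicCompletion.flat_of_isNoetherian _))
      (RingHom.Flat.of_bijective e.bijective)
  haveI : Flat (specOfAlgebra O N) := Flat.SpecMap_iff.mpr hcflat
  -- levels of `𝔪_z` are bijective for `𝒪_{X,z} → N`
  have hlev : ∀ n, Function.Bijective (Ideal.quotientMap (((maximalIdeal O) ^ n).map
      (algebraMap O N)) (algebraMap O N) Ideal.le_comap_map) := fun n => by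
    rw [hc]
    exact (quotientMap_bijective_iff_of_ringEquiv (algebraMap O Ocpl) e _).mpr
      (quotientMap_pow_bijective_adicCompletion (maximalIdeal O)
        ((isNoetherianRing_iff_ideal_fg O).mp inferInstance _) n)
  -- `W = X' ×_X Spec 𝒪_{X,z} → Spec 𝒪_{X,z}` and `P = W ×_{𝒪_{X,z}} Spec N → Spec N` are blow-ups
  let q : pullback π (X.fromSpecStalk (π x')) ⟶ Spec (.of O) := pullback.snd π (X.fromSpecStalk (π x'))
  haveI : Flat (X.fromSpecStalk (π x')) := flat_fromSpecStalk X (π x')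
  have hW : IsBlowup q (I.comap (X.fromSpecStalk (π x'))) := hπ.pullback_snd_of_flat (X.fromSpecStalk (π x'))
  have hcentre' : (stalkIdeal I (π x')).map (algebraMap O N) =
      (nodalCentre Λ c t).map (AlgebraicNodeRing.toNodeDeformationRing Λ (c * t ^ 2)).toRingHom := by
    rw [hc, ← Ideal.map_map]; exact hcentre
  have hP := hW.pullback_snd_of_flat (specOfAlgebra O N)
  rw [← Scheme.IdealSheafData.comap_comp, specOfAlgebra, comap_SpecMap_comp_fromSpecStalk_eq_ofIdealTop,
    CommRingCat.hom_ofHom, hcentre'] at hP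
  -- lift `x'` to `w ∈ W` over the closed point, then to `y ∈ P` over the closed point
  obtain ⟨w, hw, hwsnd⟩ := Scheme.Pullback.exists_preimage_pullback (f := π) (g := X.fromSpecStalk (π x'))
    x' (closedPoint O) (by rw [Scheme.fromSpecStalk_closedPoint])
  have hqw : q w = closedPoint O := hwsnd
  obtain ⟨y, hy, hysnd⟩ := Scheme.Pullback.exists_preimage_pullback (f := q) (g := specOfAlgebra O N) w
    (closedPoint N) (by rw [hqw, specOfAlgebra, Spec_closedPoint])
  subst hy
  -- the charts (file 2)
  obtain ⟨j, 𝔔, h𝔔, E_C, h𝔔Λ, hE_C⟩ := exists_chart_localCpl_equiv_of_isBlowup_nodeDeformationRing Λ c t ht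
    (pullback.snd q (specOfAlgebra O N)) hP y hysnd
  -- `𝒪̂_{W,w} ≅ 𝒪̂_{P,y}` (file 1)
  have h𝔫 : (maximalIdeal O).map (algebraMap O (StalkOver q (pullback.fst q (specOfAlgebra O N) y))) ≤
      localMaxIdeal _ :=
    map_le_localMaxIdeal_of_le_asIdeal _ _ (by rw [hqw]; exact le_rfl)
  obtain ⟨E_B, hE_B⟩ := exists_localCpl_equiv_stalk_pullback_forall_of N q _ (maximalIdeal O) hlev h𝔫 y rfl
  -- `𝒪_{X',x'} ≅ 𝒪_{W,w}` (base change of the flat preimmersion `Spec 𝒪_{X,z} → X`)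
  haveI : IsIso ((pullback.fst π (X.fromSpecStalk (π x'))).stalkMap (pullback.fst q (specOfAlgebra O N) y)) :=
    isIso_stalkMap_of_flat_of_isPreimmersion _ _
  let εW : ↥(X'.presheaf.stalk x') ≃+* StalkOver q (pullback.fst q (specOfAlgebra O N) y) :=
    ((X'.presheaf.stalkCongr (.of_eq hw.symm)) ≪≫
      asIso ((pullback.fst π (X.fromSpecStalk (π x'))).stalkMap
        (pullback.fst q (specOfAlgebra O N) y))).commRingCatIsoToRingEquiv
  obtain ⟨E_W, hE_W⟩ := exists_localCpl_equiv_of_ringEquiv εW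
  refine ⟨j, 𝔔, h𝔔, (E_W.trans E_B).trans E_C, h𝔔Λ, fun a => ?_⟩
  have hsplit : ((π ≫ f).stalkMap x').hom a = (π.stalkMap x').hom ((f.stalkMap (π x')).hom a) := by
    rw [Scheme.Hom.stalkMap_comp]; rfl
  rw [hsplit]
  -- the structure maps: `𝒪_{Y,f z} → 𝒪_{X',x'} → 𝒪_{W,w} → 𝒪_{P,y}` is `𝒪_{Y,f z} → Λ → 𝒪_{P,y}`
  have hring : f.stalkMap (π x') ≫ CommRingCat.ofHom (algebraMap O N) =
      CommRingCat.ofHom β ≫ CommRingCat.ofHom (algebraMap Λ N) := by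
    ext b
    exact hcompat b
  have hring' : Spec.map (CommRingCat.ofHom (algebraMap O N)) ≫ Spec.map (f.stalkMap (π x')) =
      Spec.map (CommRingCat.ofHom (algebraMap Λ N)) ≫ Spec.map (CommRingCat.ofHom β) := by
    have h1 := congrArg Spec.map hring
    simp only [Spec.map_comp] at h1
    exact h1
  have hkey : (pullback.fst q (specOfAlgebra O N)) ≫ (pullback.fst π (X.fromSpecStalk (π x'))) ≫ π ≫ f = (pullback.snd q (specOfAlgebra O N) ≫ Spec.map (CommRingCat.ofHom (algebraMap Λ N))) ≫ Spec.map (CommRingCat.ofHom β) ≫ Y.fromSpecStalk (f (π x')) := by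
    rw [pullback.condition_assoc]
    change (pullback.fst q (specOfAlgebra O N)) ≫ q ≫ X.fromSpecStalk (π x') ≫ f = _
    rw [← Category.assoc, pullback.condition, Category.assoc, ← Scheme.SpecMap_stalkMap_fromSpecStalk,
      ← Category.assoc (specOfAlgebra (↑O) N), specOfAlgebra, hring']
    simp only [Category.assoc]
  have hΦ : (f.stalkMap (π x') ≫ π.stalkMap x' ≫ (X'.presheaf.stalkCongr (.of_eq hw.symm)).hom ≫
        (pullback.fst π (X.fromSpecStalk (π x'))).stalkMap ((pullback.fst q (specOfAlgebra O N)) y) ≫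
        ((pullback π (X.fromSpecStalk (π x'))).presheaf.stalkCongr (.of_eq (rfl : (pullback.fst q (specOfAlgebra O N)) y = _).symm)).hom ≫ (pullback.fst q (specOfAlgebra O N)).stalkMap y) =
      CommRingCat.ofHom (algebraMap (Y.presheaf.stalk (f (π x'))) (StalkOver ((pullback.snd q (specOfAlgebra O N) ≫ Spec.map (CommRingCat.ofHom (algebraMap Λ N))) ≫ Spec.map (CommRingCat.ofHom β)) y)) := by
    apply stalk_hom_ext_of_specMap_comp_fromSpecStalk_eq (W := Y) (w₀ := f (π x'))
    have hl : Spec.map (f.stalkMap (π x') ≫ π.stalkMap x' ≫ (X'.presheaf.stalkCongr (.of_eq hw.symm)).hom ≫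
        (pullback.fst π (X.fromSpecStalk (π x'))).stalkMap ((pullback.fst q (specOfAlgebra O N)) y) ≫
        ((pullback π (X.fromSpecStalk (π x'))).presheaf.stalkCongr (.of_eq (rfl : (pullback.fst q (specOfAlgebra O N)) y = _).symm)).hom ≫ (pullback.fst q (specOfAlgebra O N)).stalkMap y) ≫ Y.fromSpecStalk (f (π x')) =
        (pullback q (specOfAlgebra O N)).fromSpecStalk y ≫ (pullback.fst q (specOfAlgebra O N)) ≫ (pullback.fst π (X.fromSpecStalk (π x'))) ≫ π ≫ f := by
      rw [Spec.map_comp, Spec.map_comp, Spec.map_comp, Spec.map_comp, Spec.map_comp]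
      simp only [Category.assoc]
      simp only [TopCat.Presheaf.stalkCongr_hom]
      rw [Scheme.SpecMap_stalkMap_fromSpecStalk, Scheme.SpecMap_stalkMap_fromSpecStalk_assoc,
        Scheme.SpecMap_stalkSpecializes_fromSpecStalk_assoc, Scheme.SpecMap_stalkMap_fromSpecStalk_assoc,
        Scheme.SpecMap_stalkSpecializes_fromSpecStalk_assoc, Scheme.SpecMap_stalkMap_fromSpecStalk_assoc]
    have hr : Spec.map (CommRingCat.ofHom (algebraMap (Y.presheaf.stalk (f (π x'))) (StalkOver ((pullback.snd q (specOfAlgebra O N) ≫ Spec.map (CommRingCat.ofHom (algebraMap Λ N))) ≫ Spec.map (CommRingCat.ofHom β)) y))) ≫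
        Y.fromSpecStalk (f (π x')) =
        (pullback q (specOfAlgebra O N)).fromSpecStalk y ≫ (pullback.fst q (specOfAlgebra O N)) ≫ (pullback.fst π (X.fromSpecStalk (π x'))) ≫ π ≫ f := by
      rw [← fromSpecStalk_comp_eq, stalkOver_fromSpec_eq, hkey]
      simp only [Category.assoc]
      rfl
    exact hl.trans hr.symm
  have hBIG : ((pullback.fst q (specOfAlgebra O N)).stalkMap y).hom (((pullback π (X.fromSpecStalk (π x'))).presheaf.stalkCongr
      (.of_eq (rfl : (pullback.fst q (specOfAlgebra O N)) y = _).symm)).hom (εW ((π.stalkMap x').hom ((f.stalkMap (π x')).hom a)))) =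
      algebraMap Λ (StalkOver (pullback.snd q (specOfAlgebra O N) ≫ Spec.map (CommRingCat.ofHom (algebraMap Λ N))) y) (β a) := by
    have hΦ' : (f.stalkMap (π x') ≫ π.stalkMap x' ≫ (X'.presheaf.stalkCongr (.of_eq hw.symm)).hom ≫
        (pullback.fst π (X.fromSpecStalk (π x'))).stalkMap ((pullback.fst q (specOfAlgebra O N)) y) ≫
        ((pullback π (X.fromSpecStalk (π x'))).presheaf.stalkCongr
          (.of_eq (rfl : (pullback.fst q (specOfAlgebra O N)) y = _).symm)).hom ≫
            (pullback.fst q (specOfAlgebra O N)).stalkMap y).hom =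
        algebraMap (Y.presheaf.stalk (f (π x'))) (StalkOver ((pullback.snd q (specOfAlgebra O N) ≫
          Spec.map (CommRingCat.ofHom (algebraMap Λ N))) ≫ Spec.map (CommRingCat.ofHom β)) y) :=
      congrArg CommRingCat.Hom.hom hΦ
    have h1 := congrArg (fun φ => φ a) hΦ'
    simp only [CommRingCat.hom_comp, RingHom.comp_apply] at h1
    have h2 : algebraMap (Y.presheaf.stalk (f (π x'))) (StalkOver ((pullback.snd q (specOfAlgebra O N) ≫
        Spec.map (CommRingCat.ofHom (algebraMap Λ N))) ≫ Spec.map (CommRingCat.ofHom β)) y) a =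
        algebraMap Λ (StalkOver (pullback.snd q (specOfAlgebra O N) ≫
          Spec.map (CommRingCat.ofHom (algebraMap Λ N))) y) (β a) :=
      congrArg (fun φ => φ a) (algebraMap_stalkOver_comp_specMap
        (pullback.snd q (specOfAlgebra O N) ≫ Spec.map (CommRingCat.ofHom (algebraMap Λ N))) β y)
    exact h1.trans h2
  have key : E_B (AdicCompletion.of _ _ (εW ((π.stalkMap x').hom ((f.stalkMap (π x')).hom a)))) =
      (AdicCompletion.of (localMaxIdeal ↥((pullback q (specOfAlgebra O N)).presheaf.stalk y))
        ↥((pullback q (specOfAlgebra O N)).presheaf.stalk y)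
        (algebraMap Λ (StalkOver (pullback.snd q (specOfAlgebra O N) ≫
          Spec.map (CommRingCat.ofHom (algebraMap Λ N))) y) (β a))) :=
    (hE_B _).trans (congrArg _ hBIG)
  rw [RingEquiv.trans_apply, RingEquiv.trans_apply, hE_W, key, hE_C]

end Transfer

/-! ## The quasi-split datum at the points over the chart origins -/

section QuasiSplitDatum

open DeJong1996 DeJong1996.AlgebraicNodeRing

/-- **The transfer, packaged with the quasi-split datum of the line at `x'` when the chart prime is
the origin.** In the situation of `exists_chart_localCpl_equiv_of_isBlowup_of_nodeDeformationRing_compat`,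
assume moreover that `β : 𝒪_{Y,f z} → Λ` is residually onto with `𝔪_{f z} Λ = 𝔪_Λ` (as for the Cohen
coordinates `𝒪_{Y,f z} → 𝒪̂_{Y,f z} ≅ κ⟦T₁, …, T_m⟧`). Then, besides the chart `(j, 𝔔)` and the
compatible identification `𝒪̂_{X',x'} ≅ (chart ring)_𝔔^`, one gets: **if `𝔔` contains `x̄` and `ȳ`
(the origin of the special fibre `κ[x, y]/(xy)` of the chart), the completed fibre local ring
`(𝒪_{X',x'}/𝔪_{f z}𝒪_{X',x'})^` is `κ(f z)⟦u, v⟧/(uv)` compatibly with `κ(f z)`** — the quasi-split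
rendering of the line at `x'` (file 4). [cite: DeJong1996, 3.4 Claim (ii), p. 64]
[cite: DeJong1997, proof of Prop. 5.11, p. 618] -/
theorem exists_chart_and_quasiSplitDatum_of_nodeDeformationRing_compat {X' X Y : Scheme.{u}}
    [IsLocallyNoetherian X] [IsLocallyNoetherian X'] (π : X' ⟶ X) (f : X ⟶ Y) {I : X.IdealSheafData}
    (hπ : IsBlowup π I) {x' : X'} {Λ : Type u} [CommRing Λ] [IsLocalRing Λ] [IsNoetherianRing Λ] {c t : Λ}
    (ht : t ∈ nonZeroDivisors Λ)
    (e : AdicCompletion (maximalIdeal (X.presheaf.stalk (π x'))) (X.presheaf.stalk (π x')) ≃+*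
      NodeDeformationRing Λ (c * t ^ 2))
    (hcentre : ((stalkIdeal I (π x')).map (algebraMap (X.presheaf.stalk (π x'))
        (AdicCompletion (maximalIdeal (X.presheaf.stalk (π x'))) (X.presheaf.stalk (π x'))))).map
        e.toRingHom =
      (nodalCentre Λ c t).map (AlgebraicNodeRing.toNodeDeformationRing Λ (c * t ^ 2)).toRingHom)
    (β : Y.presheaf.stalk ((π ≫ f).base x') →+* Λ)
    (hcompat : ∀ a, e (algebraMap _ _ ((f.stalkMap (π x')).hom a)) =
      algebraMap Λ (NodeDeformationRing Λ (c * t ^ 2)) (β a))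
    (hβM : (maximalIdeal (Y.presheaf.stalk ((π ≫ f).base x'))).map β = maximalIdeal Λ)
    (hβR : Function.Surjective ((Ideal.Quotient.mk (maximalIdeal Λ)).comp β)) :
    ∃ (j : Fin 3) (𝔔 : Ideal (AlgebraicNodeRing Λ (chartParam Λ c t j))) (_ : 𝔔.IsPrime)
      (E : LocalCpl (X'.presheaf.stalk x') ≃+* LocalCpl (Localization.AtPrime 𝔔)),
      (maximalIdeal Λ).map (algebraMap Λ (AlgebraicNodeRing Λ (chartParam Λ c t j))) ≤ 𝔔 ∧
      (∀ a : Y.presheaf.stalk ((π ≫ f).base x'), E (AdicCompletion.of _ _ (((π ≫ f).stalkMap x').hom a)) =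
        AdicCompletion.of _ _ (algebraMap Λ (Localization.AtPrime 𝔔) (β a))) ∧
      (u Λ (chartParam Λ c t j) ∈ 𝔔 → v Λ (chartParam Λ c t j) ∈ 𝔔 →
        ∃ eq : AdicCompletion
            ((IsLocalRing.maximalIdeal (X'.presheaf.stalk x')).map (Ideal.Quotient.mk
              ((IsLocalRing.maximalIdeal (Y.presheaf.stalk ((π ≫ f).base x'))).map ((π ≫ f).stalkMap x').hom)))
            (X'.presheaf.stalk x' ⧸
              (IsLocalRing.maximalIdeal (Y.presheaf.stalk ((π ≫ f).base x'))).map ((π ≫ f).stalkMap x').hom) ≃+*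
          MvPowerSeries (Fin 2) (Y.presheaf.stalk ((π ≫ f).base x') ⧸
              IsLocalRing.maximalIdeal (Y.presheaf.stalk ((π ≫ f).base x'))) ⧸
            Ideal.span {(MvPowerSeries.X 0 * MvPowerSeries.X 1 :
              MvPowerSeries (Fin 2) (Y.presheaf.stalk ((π ≫ f).base x') ⧸
                IsLocalRing.maximalIdeal (Y.presheaf.stalk ((π ≫ f).base x'))))},
          eq.toRingHom.comp ((algebraMap (X'.presheaf.stalk x' ⧸
              (IsLocalRing.maximalIdeal (Y.presheaf.stalk ((π ≫ f).base x'))).map ((π ≫ f).stalkMap x').hom) _).comp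
            (Ideal.quotientMap ((IsLocalRing.maximalIdeal (Y.presheaf.stalk ((π ≫ f).base x'))).map
              ((π ≫ f).stalkMap x').hom) ((π ≫ f).stalkMap x').hom Ideal.le_comap_map)) =
          algebraMap (Y.presheaf.stalk ((π ≫ f).base x') ⧸
            IsLocalRing.maximalIdeal (Y.presheaf.stalk ((π ≫ f).base x'))) _) := by
  obtain ⟨j, 𝔔, h𝔔, E, h𝔔Λ, hE⟩ :=
    exists_chart_localCpl_equiv_of_isBlowup_of_nodeDeformationRing_compat π f hπ ht e hcentre β hcompat
  refine ⟨j, 𝔔, h𝔔, E, h𝔔Λ, hE, fun hu hv => ?_⟩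
  haveI : IsNoetherianRing (MvPolynomial (Fin 2) Λ) := inferInstance
  haveI : IsNoetherianRing (AlgebraicNodeRing Λ (chartParam Λ c t j)) :=
    inferInstanceAs (IsNoetherianRing (_ ⧸ _))
  haveI : IsNoetherianRing (Localization.AtPrime 𝔔) :=
    IsLocalization.isNoetherianRing 𝔔.primeCompl (Localization.AtPrime 𝔔) inferInstance
  exact exists_fibreCpl_equiv_nodeQuot_of_chart (T := Localization.AtPrime 𝔔)
    ((π ≫ f).stalkMap x').hom β hβM hβR 𝔔 h𝔔Λ hu hv E hE

end QuasiSplitDatum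


end Summit.ResolutionOfSingularities.ResolutionOfSingularities.Theorems

end
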